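import Literature.MathematicalPhysics.KineticTheory.TaggedLinearBoltzmannSeries
import Literature.MathematicalPhysics.KineticTheory.TaggedSphereDiffusionProofs
import HarnessLib

/-!
# BGSR (6.3): reduction of the hydrodynamic limit to single Fourier modes
(Bodineau–Gallagher–Saint-Raymond, Invent. Math. 203 (2016) = arXiv:1305.3397v2, §6.1.1, (6.3);
first layers of the bottom-up proof of the named fact
`Literature.MathematicalPhysics.KineticTheory.bgsr_hydrodynamicLimit` of `TaggedSphereDiffusion`)

BGSR (6.3) is the diffusive limit of the linear Boltzmann equation (1.3): for a continuous
probability density `ρ⁰` on `T^d`,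
`sup_{τ ∈ [0,T]} sup_{(x,v)} M_β(v) |φ_α(ατ, x, v) - ρ(τ, x)| → 0` as `α → ∞`, `ρ` the heat flow
with coefficient `κ_β` (6.8). Its printed proof (§6.1.2–6.1.3: Hilbert expansion
`Ψ_α = ρ + α⁻¹ ρ₁ + α⁻² ρ₂` with the correctors `b` (6.5) and `D` (6.7), plus a maximum principle)
opens with the sentence (§6.1.1, after (6.3)): *"Notice that by the maximum principle on the heat
equation, we may assume without loss of generality (up to regularizing `ρ⁰`) that `ρ⁰` belongs to
`C⁴(T^d)`"*. This file PROVES that reduction in a strong form, in two layers: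

* **Layer 1** (`bgsr_hydrodynamicLimit_of_trigPoly`): it suffices to know (6.3) for initial data
  that are (real, nonnegative, unit-mass) *trigonometric polynomials*
  (`bgsr_hydrodynamicLimit_trigPoly`; these are `C^∞ ⊂ C⁴`, so the paper's `C⁴` case implies it).
* **Layer 2** (`bgsr_hydrodynamicLimit_trigPoly_of_mode`, `bgsr_hydrodynamicLimit_of_mode`): by
  linearity of both flows it suffices to know (6.3) for the *elementary single-mode densities*
  `1 + a₁ cos(2π n·x) + a₂ sin(2π n·x)`, `n ∈ ℤ^d ∖ {0}`, `|a₁| + |a₂| ≤ 1`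
  (`bgsr_hydrodynamicLimit_mode`, the named sub-fact that remains).

## Layer 1 (BGSR §6.1.1 "up to regularizing `ρ⁰`", made quantitative)

1. *Density* (`exists_isRealTrigPoly_near`): real parts of the complex span of the Fourier
   monomials `e_n(x) = exp(2πi n·x)` are uniformly dense in `C(T^d, ℝ)` — Stone–Weierstrass on the
   torus, Mathlib's `UnitAddTorus.span_mFourier_closure_eq_top`.
2. *Admissible approximants* (`exists_isRealTrigPoly_density_near`): shifting by the error and
   renormalising the mass keeps a trigonometric polynomial and makes it a probability density,
   at the cost of a factor `4(‖ρ⁰‖_∞ + 1)` in the uniform error.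
3. *Two maximum principles*: the solution map `ρ⁰ ↦ φ_α(t)` of (1.3) in the class
   `IsTaggedLinearBoltzmannSolution` is an `L^∞`-contraction (`abs_linearBoltzmannSeries_sub_le`:
   every solution in the class is the collision series of `TaggedLinearBoltzmannSeries`, which is
   additive in the datum, fixes constants and preserves `0 ≤ · ≤ R`), and so is the heat flow
   `ρ⁰ ↦ G_{2κτ} * ρ⁰` (`abs_torusHeatSolution_sub_le`, an average against a probability measure).
4. *Assembly* (`bgsr_hydrodynamicLimit_of_trigPoly`): with `M_β ≤ M_β(0)`, an `e/(4 M_β(0))`-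
   approximation of `ρ⁰` by an admissible trigonometric polynomial `p` and the sub-fact for `p`
   at accuracy `e/2` give (6.3) for `ρ⁰` at accuracy `e`, for the threshold `α₀ ∨ 0`.

## Layer 2 (linearity)

5. *Elementary densities* (`modeDensity`): `ρ_{n,a₁,a₂} = 1 + a₁ Re e_n + a₂ Im e_n` is a
   trigonometric polynomial, nonnegative for `|a₁| + |a₂| ≤ 1`, of unit mass for `n ≠ 0`
   (`integral_mFourier_eq_zero`: a half-period shift in a coordinate with `n_i ≠ 0` flips the sign
   of `e_n`, and Lebesgue measure on `T^d` is translation invariant).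
6. *Decomposition* (`IsRealTrigPoly.exists_decomposition`): a real trigonometric polynomial is
   `K + ∑_{n ∈ S} λ_n ρ_n` with `0 ∉ S` finite, `λ_n = |Re c_n| + |Im c_n| ≥ 0`, elementary `ρ_n`
   and a real constant `K` (`Re(c_n e_n) = λ_n (ρ_n - 1)`).
7. *Linearity over nonnegative combinations* of both flows (`linearBoltzmannSeries_finset_sum`,
   `torusHeatSolution_finset_sum`; constants are fixed points of both): from
   `ρ⁰ + K⁻ = K⁺ + ∑ λ_n ρ_n` one gets `φ[ρ⁰](ατ) - ρ[ρ⁰](τ) = ∑ λ_n (φ[ρ_n](ατ) - ρ[ρ_n](τ))`,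
   and the single-mode statement at accuracy `e/(∑ λ_n + 1)` beyond the largest of finitely many
   thresholds gives the trigonometric-polynomial statement (`bgsr_hydrodynamicLimit_trigPoly_of_mode`).

## What remains of (6.3) (recorded for the next layers; see the folder NOTES of the fact's owner)

`bgsr_hydrodynamicLimit_mode`: (6.3) for the datum `1 + a₁ cos(2π n·x) + a₂ sin(2π n·x)`. There
the heat flow is explicit (`1 + e^{-4π² κ_β |n|² τ}(a₁ cos + a₂ sin)`), and by translation
covariance and uniqueness in the class the solution separates, `φ = 1 + Re((a₁ - i a₂) e_n(x)
ĝ_n(t, v))`, so the remaining analysis is velocity-only: an `L²(M_β dv)` energy estimate for the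
two-term expansion built on the correctors `b` (6.5) and `D` (6.7) of
`TaggedSphereDiffusionCorrector` (finite energy suffices there), the isotropy `∫ v ⊗ b M_β = κ_β Id`
behind (6.8), and an `L² → M_β`-weighted `L^∞` step through one Duhamel iteration. The
`M_β`-weighted maximum principle displayed in §6.1.3 cannot hold with a constant uniform in `α`
(the velocity process at rate `α²` drives `M_β R` towards `M_β ∫ R M_β⁻¹ M_β`, which is not
controlled by `sup M_β R(0)`); polynomial velocity weights, or the energy route above, replace it.
None of this affects the statement (6.3).

## References

* T. Bodineau, I. Gallagher, L. Saint-Raymond, *The Brownian motion as the limit of a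
  deterministic system of hard-spheres*, Invent. Math. 203 (2016) 493–553 = arXiv:1305.3397v2,
  §6.1.1 (reduction to smooth data), (6.3), Remark 3.5 (maximum principle for (1.3)).
* A. Bensoussan, J.-L. Lions, G. Papanicolaou, *Boundary layers and homogenization of transport
  processes*, Publ. RIMS 15 (1979) 53–157 (BGSR's [6]).
* L. Grafakos, *Classical Fourier Analysis* (3rd ed., 2014), §3.1–3.2 (Fourier monomials on `T^n`,
  density of trigonometric polynomials in `C(T^n)`).
-/

open MeasureTheory Metric Set Filter Topology ProbabilityTheory
open scoped InnerProductSpace ENNReal ComplexConjugate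

namespace Literature.MathematicalPhysics.KineticTheory

noncomputable section

open Literature.Analysis.FunctionSpaces (maxwellianBeta maxwellianBeta_pos)

variable {d : Type*} [Fintype d]

local notation "𝔼" => EuclideanSpace ℝ d
local notation "𝕋" => UnitAddTorus d

/-! ## Real trigonometric polynomials on `T^d` -/

/-- `ρ : T^d → ℝ` is a *real trigonometric polynomial*: it agrees pointwise with an element of
the complex linear span of the Fourier monomials `e_n(x) = exp(2πi n·x)`, `n ∈ ℤ^d` (Mathlib's
`UnitAddTorus.mFourier n`). [folklore] -/
def IsRealTrigPoly (ρ : 𝕋 → ℝ) : Prop :=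
  ∃ P ∈ Submodule.span ℂ (Set.range (UnitAddTorus.mFourier (d := d))), ∀ x, (ρ x : ℂ) = P x

omit [Fintype d] in
/-- The defining unfolding of `IsRealTrigPoly`. [folklore] -/
theorem isRealTrigPoly_def [Fintype d] (ρ : 𝕋 → ℝ) :
    IsRealTrigPoly ρ ↔
      ∃ P ∈ Submodule.span ℂ (Set.range (UnitAddTorus.mFourier (d := d))), ∀ x, (ρ x : ℂ) = P x :=
  Iff.rfl

/-- A real trigonometric polynomial is continuous. [folklore] -/
theorem IsRealTrigPoly.continuous {ρ : 𝕋 → ℝ} (h : IsRealTrigPoly ρ) : Continuous ρ := by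
  obtain ⟨P, -, hP⟩ := h
  have e : ρ = fun x => (P x).re := funext fun x => by rw [← hP x, Complex.ofReal_re]
  rw [e]
  exact Complex.continuous_re.comp P.continuous

/-- Constants are real trigonometric polynomials (`e_0 = 1`). [folklore] -/
theorem isRealTrigPoly_const (c : ℝ) : IsRealTrigPoly (fun _ : 𝕋 => c) := by
  refine ⟨(c : ℂ) • UnitAddTorus.mFourier 0,
    Submodule.smul_mem _ _ (Submodule.subset_span ⟨0, rfl⟩), fun x => ?_⟩
  simp [UnitAddTorus.mFourier_zero]

/-- Sums of real trigonometric polynomials are real trigonometric polynomials. [folklore] -/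
theorem IsRealTrigPoly.add {ρ σ : 𝕋 → ℝ} (hρ : IsRealTrigPoly ρ) (hσ : IsRealTrigPoly σ) :
    IsRealTrigPoly fun x => ρ x + σ x := by
  obtain ⟨P, hP, hP'⟩ := hρ
  obtain ⟨Q, hQ, hQ'⟩ := hσ
  exact ⟨P + Q, Submodule.add_mem _ hP hQ, fun x => by simp [hP' x, hQ' x]⟩

/-- Real multiples of real trigonometric polynomials are real trigonometric polynomials.
[folklore] -/
theorem IsRealTrigPoly.const_mul {ρ : 𝕋 → ℝ} (hρ : IsRealTrigPoly ρ) (c : ℝ) :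
    IsRealTrigPoly fun x => c * ρ x := by
  obtain ⟨P, hP, hP'⟩ := hρ
  exact ⟨(c : ℂ) • P, Submodule.smul_mem _ _ hP, fun x => by simp [hP' x]⟩

/-- The span of the Fourier monomials is closed under complex conjugation (it is the underlying
submodule of the star subalgebra `UnitAddTorus.mFourierSubalgebra`). [folklore] -/
theorem star_mem_span_mFourier {Q : C(𝕋, ℂ)}
    (hQ : Q ∈ Submodule.span ℂ (Set.range (UnitAddTorus.mFourier (d := d)))) :
    star Q ∈ Submodule.span ℂ (Set.range (UnitAddTorus.mFourier (d := d))) := by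
  rw [← UnitAddTorus.mFourierSubalgebra_coe] at hQ ⊢
  rw [Subalgebra.mem_toSubmodule, StarSubalgebra.mem_toSubalgebra] at hQ ⊢
  exact star_mem hQ

/-- **Density of real trigonometric polynomials in `C(T^d, ℝ)`** (Stone–Weierstrass on the torus:
the complex span of the Fourier monomials is uniformly dense in `C(T^d, ℂ)`,
`UnitAddTorus.span_mFourier_closure_eq_top`, and real parts of its elements stay in it).
[cite: Grafakos2014, §3.1] -/
theorem exists_isRealTrigPoly_near {ρ : 𝕋 → ℝ} (hρ : Continuous ρ) {δ : ℝ} (hδ : 0 < δ) :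
    ∃ p : 𝕋 → ℝ, IsRealTrigPoly p ∧ ∀ x, |ρ x - p x| ≤ δ := by
  set S : Submodule ℂ C(𝕋, ℂ) := Submodule.span ℂ (Set.range (UnitAddTorus.mFourier (d := d)))
    with hS
  set F : C(𝕋, ℂ) := ⟨fun x => (ρ x : ℂ), Complex.continuous_ofReal.comp hρ⟩ with hF_def
  have hF : F ∈ closure (S : Set C(𝕋, ℂ)) := by
    rw [← Submodule.topologicalClosure_coe, hS, UnitAddTorus.span_mFourier_closure_eq_top]
    exact Submodule.mem_top
  obtain ⟨Q, hQ, hFQ⟩ := Metric.mem_closure_iff.1 hF δ hδ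
  refine ⟨fun x => (Q x).re, ⟨(2⁻¹ : ℂ) • (Q + star Q),
    Submodule.smul_mem _ _ (Submodule.add_mem _ hQ (star_mem_span_mFourier hQ)), fun x => ?_⟩,
    fun x => ?_⟩
  · simp only [ContinuousMap.coe_smul, ContinuousMap.coe_add, Pi.smul_apply, Pi.add_apply,
      ContinuousMap.star_apply, smul_eq_mul, Complex.star_def, Complex.re_eq_add_conj]
    ring
  · have h1 : ρ x - (Q x).re = (F x - Q x).re := by
      simp [hF_def]
    rw [h1]
    calc |(F x - Q x).re| ≤ ‖F x - Q x‖ := Complex.abs_re_le_norm _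
      _ = ‖(F - Q) x‖ := rfl
      _ ≤ ‖F - Q‖ := ContinuousMap.norm_coe_le_norm _ x
      _ = dist F Q := (dist_eq_norm F Q).symm
      _ ≤ δ := hFQ.le

/-- On the torus (a probability space) the integral of a constant is the constant. [folklore] -/
theorem integral_const_unitAddTorus (c : ℝ) : ∫ _ : 𝕋, c = c := by
  simp

/-- **Admissible trigonometric approximants of a probability density.** A continuous probability
density `ρ⁰` on `T^d` is, for every `δ > 0`, uniformly `δ`-close to a real trigonometric
polynomial which is itself a probability density (nonnegative, unit mass): shift a uniform
approximant up by its error and renormalise its mass. [folklore] -/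
theorem exists_isRealTrigPoly_density_near {ρ : 𝕋 → ℝ} (hρ : Continuous ρ) (hρ0 : ∀ x, 0 ≤ ρ x)
    (hρ1 : ∫ x, ρ x = 1) {δ : ℝ} (hδ : 0 < δ) :
    ∃ p : 𝕋 → ℝ, IsRealTrigPoly p ∧ (∀ x, 0 ≤ p x) ∧ ∫ x, p x = 1 ∧ ∀ x, |ρ x - p x| ≤ δ := by
  obtain ⟨R, hR⟩ := exists_abs_le_of_continuous hρ
  have hR0 : 0 ≤ R := (abs_nonneg _).trans (hR 0)
  -- accuracy of the raw approximant
  set η : ℝ := min 4⁻¹ (δ / (4 * (R + 1))) with hη_def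
  have hη : 0 < η := lt_min (by norm_num) (by positivity)
  have hη4 : η ≤ 4⁻¹ := min_le_left _ _
  have hηδ : η ≤ δ / (4 * (R + 1)) := min_le_right _ _
  obtain ⟨p₀, hp₀, hp₀ρ⟩ := exists_isRealTrigPoly_near hρ hη
  -- the shifted approximant `q = p₀ + η ≥ 0`, `|ρ - q| ≤ 2η`
  set q : 𝕋 → ℝ := fun x => p₀ x + η with hq_def
  have hq : IsRealTrigPoly q := hp₀.add (isRealTrigPoly_const η)
  have hqc : Continuous q := hq.continuous
  have hq0 : ∀ x, 0 ≤ q x := fun x => by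
    have := (abs_le.1 (hp₀ρ x)).2
    simp only [hq_def]
    linarith [hρ0 x]
  have hqρ : ∀ x, |ρ x - q x| ≤ 2 * η := fun x => by
    have := abs_le.1 (hp₀ρ x)
    simp only [hq_def]
    rw [abs_le]
    constructor <;> linarith
  have hqR : ∀ x, |q x| ≤ R + 2 * η := fun x => by
    have h1 := abs_sub_abs_le_abs_sub (q x) (ρ x)
    rw [abs_sub_comm] at h1
    linarith [hR x, hqρ x]
  -- its mass `m` is within `2η` of `1`
  set m : ℝ := ∫ x, q x with hm_def
  have hqi : Integrable q := hqc.integrable_unitAddTorus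
  have hρi : Integrable ρ := hρ.integrable_unitAddTorus
  have hm1 : |m - 1| ≤ 2 * η := by
    have e1 : m - 1 = ∫ x, (q x - ρ x) := by
      rw [integral_sub hqi hρi, hρ1]
    rw [e1]
    calc |∫ x, (q x - ρ x)| ≤ ∫ x, |q x - ρ x| := abs_integral_le_integral_abs
      _ ≤ ∫ _ : 𝕋, 2 * η := integral_mono (hqi.sub hρi).abs (integrable_const _) fun x => by
          rw [abs_sub_comm]; exact hqρ x
      _ = 2 * η := integral_const_unitAddTorus _
  have hm_pos : 0 < m := by
    have := (abs_le.1 hm1).1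
    linarith
  have hm_ge : 2⁻¹ ≤ m := by
    have := (abs_le.1 hm1).1
    linarith
  -- the renormalised approximant
  refine ⟨fun x => m⁻¹ * q x, hq.const_mul m⁻¹, fun x => mul_nonneg (inv_nonneg.2 hm_pos.le) (hq0 x),
    ?_, fun x => ?_⟩
  · rw [integral_const_mul, ← hm_def, inv_mul_cancel₀ hm_pos.ne']
  · -- `|ρ - q/m| ≤ |ρ - q| + |q| |1 - 1/m| ≤ 2η + (R + 2η) 2η / m ≤ 4η (R + 1) ≤ δ`
    have h1 : |ρ x - m⁻¹ * q x| ≤ |ρ x - q x| + |q x| * |1 - m⁻¹| := by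
      calc |ρ x - m⁻¹ * q x| = |(ρ x - q x) + q x * (1 - m⁻¹)| := by ring_nf
        _ ≤ |ρ x - q x| + |q x * (1 - m⁻¹)| := abs_add_le _ _
        _ = |ρ x - q x| + |q x| * |1 - m⁻¹| := by rw [abs_mul]
    have h2 : |1 - m⁻¹| ≤ 2 * (2 * η) := by
      rw [show (1 : ℝ) - m⁻¹ = (m - 1) * m⁻¹ by field_simp, abs_mul, abs_of_pos (inv_pos.2 hm_pos)]
      calc |m - 1| * m⁻¹ ≤ 2 * η * 2 := by
            refine mul_le_mul hm1 ?_ (inv_nonneg.2 hm_pos.le) (by positivity)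
            rw [inv_le_comm₀ hm_pos two_pos]
            exact hm_ge
        _ = 2 * (2 * η) := by ring
    have h3 : |q x| * |1 - m⁻¹| ≤ (R + 2 * η) * (2 * (2 * η)) :=
      mul_le_mul (hqR x) h2 (abs_nonneg _) (by positivity)
    have h4 : (R + 2 * η) * (2 * (2 * η)) ≤ (R + 1) * (2 * (2 * η)) - 2 * η := by
      nlinarith
    have h5 : (R + 1) * (2 * (2 * η)) - 2 * η + 2 * η ≤ δ := by
      have : η * (4 * (R + 1)) ≤ δ := (le_div_iff₀ (by positivity)).1 hηδ
      linarith
    linarith [hqρ x]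

/-! ## Two maximum principles: contraction of the solution maps in the datum -/

/-- **`L^∞`-contraction of BGSR's linear Boltzmann flow in the datum** (maximum principle,
BGSR Remark 3.5, for differences): for continuous nonnegative data `f, g` on `T^d` with
`|f - g| ≤ c`, the collision-series solutions of (1.3) satisfy `|φ[f](t) - φ[g](t)| ≤ c`
(write `f + c = g + h` with `0 ≤ h := f - g + c ≤ 2c`; the series is additive in admissible data,
fixes constants and maps `0 ≤ h ≤ 2c` to `[0, 2c]`).
[cite: BodineauGallagherSaintRaymondInvent2016, Remark 3.5] -/
theorem abs_linearBoltzmannSeries_sub_le {β α : ℝ} (hβ : 0 < β) (hα : 0 ≤ α) {f g : 𝕋 → ℝ}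
    (hf : Continuous f) (hg : Continuous g) (hf0 : ∀ x, 0 ≤ f x) (hg0 : ∀ x, 0 ≤ g x)
    {c : ℝ} (hc : ∀ x, |f x - g x| ≤ c) (t : ℝ) (x : 𝕋) (v : 𝔼) :
    |linearBoltzmannSeries (Literature.Analysis.FluidPDE.Torus.geometry d) β α (fun x _ => f x) t x v -
        linearBoltzmannSeries (Literature.Analysis.FluidPDE.Torus.geometry d) β α (fun x _ => g x) t x v| ≤
      c := by
  obtain ⟨Rf, hRf⟩ := exists_upper_bound_of_continuous hf
  obtain ⟨Rg, hRg⟩ := exists_upper_bound_of_continuous hg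
  have hc0 : 0 ≤ c := (abs_nonneg _).trans (hc 0)
  set h : 𝕋 → ℝ := fun x => f x - g x + c with hh_def
  have Df := linearBoltzmannData_torus (d := d) hβ hα hf hf0 hRf
  have Dg := linearBoltzmannData_torus (d := d) hβ hα hg hg0 hRg
  have Dc := linearBoltzmannData_torus (d := d) hβ hα (continuous_const (y := c)) (fun _ => hc0)
    (fun _ => le_rfl)
  have Dh : LinearBoltzmannData (Literature.Analysis.FluidPDE.Torus.geometry d) β α (fun x _ => h x)
      (2 * c) :=
    linearBoltzmannData_torus (d := d) hβ hα ((hf.sub hg).add continuous_const)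
      (fun x => by have := (abs_le.1 (hc x)).1; show 0 ≤ f x - g x + c; linarith)
      (fun x => by have := (abs_le.1 (hc x)).2; show f x - g x + c ≤ 2 * c; linarith)
  set G := Literature.Analysis.FluidPDE.Torus.geometry d
  -- `φ[f] + c = φ[f + c] = φ[g + h] = φ[g] + φ[h]`
  have e1 : linearBoltzmannSeries G β α (fun x _ => f x) t x v + c =
      linearBoltzmannSeries G β α (fun x _ => g x) t x v +
        linearBoltzmannSeries G β α (fun x _ => h x) t x v := by
    have efc : (fun (x : 𝕋) (_ : 𝔼) => f x + c) = fun (x : 𝕋) (_ : 𝔼) => g x + h x := by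
      funext x w; simp only [hh_def]; ring
    have h1 := linearBoltzmannSeries_add Df Dc t x v
    have h2 := linearBoltzmannSeries_add Dg Dh t x v
    rw [linearBoltzmannSeries_const Dc.continuous_translate hβ hα c t x v] at h1
    rw [← h1, efc, h2]
  have hmem := Dh.linearBoltzmannSeries_mem t x v
  rw [abs_le]
  constructor <;> linarith [hmem.1, hmem.2]

/-- The wrapped-Gaussian average of a bounded continuous function is an integral of an
integrable function. [folklore] -/
theorem integrable_torusHeat_integrand (κ : ℝ) {f : 𝕋 → ℝ} (hf : Continuous f) (τ : ℝ) (x : 𝕋) :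
    Integrable (fun z : 𝔼 => f (x - Literature.Analysis.FunctionSpaces.Torus.proj (Real.sqrt (2 * κ * τ) • z)))
      (stdGaussian 𝔼) := by
  obtain ⟨R, hR⟩ := exists_abs_le_of_continuous hf
  have hw : Continuous fun z : 𝔼 =>
      Literature.Analysis.FunctionSpaces.Torus.proj (Real.sqrt (2 * κ * τ) • z) :=
    Literature.Analysis.FunctionSpaces.Torus.continuous_proj.comp (continuous_const_smul _)
  exact Integrable.mono' (integrable_const R)
    (hf.comp (continuous_const.sub hw)).aestronglyMeasurable
    (Eventually.of_forall fun z => by rw [Real.norm_eq_abs]; exact hR _)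

/-- The heat flow on the torus is linear in the datum: differences. [folklore] -/
theorem torusHeatSolution_sub (κ : ℝ) {f g : 𝕋 → ℝ} (hf : Continuous f) (hg : Continuous g)
    (τ : ℝ) (x : 𝕋) :
    torusHeatSolution κ f τ x - torusHeatSolution κ g τ x =
      torusHeatSolution κ (fun y => f y - g y) τ x := by
  unfold torusHeatSolution
  rw [← integral_sub (integrable_torusHeat_integrand κ hf τ x) (integrable_torusHeat_integrand κ hg τ x)]

/-- **`L^∞`-contraction of the heat flow on `T^d` in the datum** ("the maximum principle on the
heat equation" invoked in BGSR §6.1.1): `|f - g| ≤ c` implies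
`|G_{2κτ} * f - G_{2κτ} * g| ≤ c`. [cite: BodineauGallagherSaintRaymondInvent2016, §6.1.1] -/
theorem abs_torusHeatSolution_sub_le (κ : ℝ) {f g : 𝕋 → ℝ} (hf : Continuous f) (hg : Continuous g)
    {c : ℝ} (hc : ∀ x, |f x - g x| ≤ c) (τ : ℝ) (x : 𝕋) :
    |torusHeatSolution κ f τ x - torusHeatSolution κ g τ x| ≤ c := by
  rw [torusHeatSolution_sub κ hf hg τ x]
  exact abs_torusHeatSolution_le κ hc τ x

/-! ## The named sub-fact: (6.3) for trigonometric-polynomial data -/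

/-- **BGSR (6.3) for smooth (trigonometric-polynomial) data** — the case to which the paper
reduces at once: *"by the maximum principle on the heat equation, we may assume without loss of
generality (up to regularizing `ρ⁰`) that `ρ⁰` belongs to `C⁴(T^d)`"* (§6.1.1, after (6.3)).
Verbatim `bgsr_hydrodynamicLimit` (`d ≥ 2`, `β > 0`, a corrector `b` of (6.5) fixing `κ_β` (6.8),
`T > 0`, `e > 0`, a threshold `α₀` beyond which every solution `φ` of (1.3) with rate `α` and
datum `ρ⁰` in the class `IsTaggedLinearBoltzmannSolution` satisfies
`M_β(v) |φ(ατ, x, v) - ρ(τ, x)| ≤ e` on `[0, T] × T^d × ℝ^d`, `ρ = torusHeatSolution κ_β ρ⁰`),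
EXCEPT that the continuous probability density `ρ⁰` is moreover a real trigonometric polynomial
(`IsRealTrigPoly`, a finite sum of Fourier modes — in particular `C^∞ ⊂ C⁴`, so this is implied
by the printed `C⁴` case and implies the general case, `bgsr_hydrodynamicLimit_of_trigPoly`).
[cite: BodineauGallagherSaintRaymondInvent2016, (6.3) and §6.1.1] -/
def bgsr_hydrodynamicLimit_trigPoly : Prop :=
  ∀ (hd : 2 ≤ Fintype.card d) {β : ℝ} (hβ : 0 < β) (b : 𝔼 → 𝔼) (hb : IsDiffusionCorrector β b)
    (ρ₀ : 𝕋 → ℝ) (hρ₀ : IsRealTrigPoly ρ₀) (hρ₀0 : ∀ x, 0 ≤ ρ₀ x) (hρ₀1 : ∫ x, ρ₀ x = 1)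
    {T : ℝ} (hT : 0 < T) {e : ℝ} (he : 0 < e),
    ∃ α₀ : ℝ, ∀ α : ℝ, α₀ ≤ α → ∀ φ : ℝ → 𝕋 → 𝔼 → ℝ,
      IsTaggedLinearBoltzmannSolution β α ρ₀ φ →
      ∀ τ ∈ Icc 0 T, ∀ (x : 𝕋) (v : 𝔼),
        maxwellianBeta β v *
          |φ (α * τ) x v - torusHeatSolution (bgsrDiffusionCoeff β b) ρ₀ τ x| ≤ e

/-- (6.3) restricted to trigonometric-polynomial data is a special case of (6.3). [folklore] -/
theorem bgsr_hydrodynamicLimit_trigPoly_of (h : bgsr_hydrodynamicLimit (d := d)) :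
    bgsr_hydrodynamicLimit_trigPoly (d := d) :=
  fun hd _ hβ b hb ρ₀ hρ₀ hρ₀0 hρ₀1 _ hT _ he => h hd hβ b hb ρ₀ hρ₀.continuous hρ₀0 hρ₀1 hT he

/-- **BGSR (6.3) from its smooth-data case** (the regularisation step of §6.1.1, proved): if the
hydrodynamic limit (6.3) holds for trigonometric-polynomial probability densities, it holds for
every continuous probability density `ρ⁰`. Given `e > 0`, approximate `ρ⁰` uniformly within
`e / (4 M_β(0))` by an admissible trigonometric polynomial `p`
(`exists_isRealTrigPoly_density_near`); every solution `φ` with datum `ρ⁰` is within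
`e / (4 M_β(0))` of the solution with datum `p` (`abs_linearBoltzmannSeries_sub_le` and the
identification `IsTaggedLinearBoltzmannSolution.eq_linearBoltzmannSeries`), the two heat flows are
equally close (`abs_torusHeatSolution_sub_le`), and the sub-fact for `p` at accuracy `e/2`
concludes, with the same threshold `α₀ ∨ 0`.
[cite: BodineauGallagherSaintRaymondInvent2016, §6.1.1 and (6.3)] -/
theorem bgsr_hydrodynamicLimit_of_trigPoly (h : bgsr_hydrodynamicLimit_trigPoly (d := d)) :
    bgsr_hydrodynamicLimit (d := d) := by
  intro hd β hβ b hb ρ₀ hρ₀ hρ₀0 hρ₀1 T hT e he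
  -- `M_β ≤ M₀ := M_β(0)`
  set M₀ : ℝ := (2 * Real.pi * β⁻¹) ^ (-(Module.finrank ℝ 𝔼 : ℝ) / 2) with hM₀_def
  have hM₀ : 0 < M₀ := Real.rpow_pos_of_pos (by positivity) _
  have hMle : ∀ v : 𝔼, maxwellianBeta β v ≤ M₀ := fun v => maxwellianBeta_le hβ v
  -- an admissible trigonometric approximant at accuracy `δ = e / (4 M₀)`
  set δ : ℝ := e / (4 * M₀) with hδ_def
  have hδ : 0 < δ := by positivity
  obtain ⟨p, hp, hp0, hp1, hpρ⟩ := exists_isRealTrigPoly_density_near hρ₀ hρ₀0 hρ₀1 hδ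
  -- the sub-fact for `p` at accuracy `e / 2`
  obtain ⟨α₀, hα₀⟩ := h hd hβ b hb p hp hp0 hp1 hT (half_pos he)
  refine ⟨max α₀ 0, fun α hα φ hφ τ hτ x v => ?_⟩
  have hα0 : 0 ≤ α := le_of_max_le_right hα
  have hαα₀ : α₀ ≤ α := le_of_max_le_left hα
  -- the solution with datum `p`, and the sub-fact applied to it
  obtain ⟨Rp, hRp⟩ := exists_upper_bound_of_continuous hp.continuous
  obtain ⟨ψ, hψ, -⟩ := exists_isTaggedLinearBoltzmannSolution hβ hα0 hp.continuous hp0 hRp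
  have key := hα₀ α hαα₀ ψ hψ τ hτ x v
  -- both solutions are collision series at the time `α τ ≥ 0`
  have ht : 0 ≤ α * τ := mul_nonneg hα0 hτ.1
  have eφ := congrFun (congrFun (hφ.eq_linearBoltzmannSeries hβ hα0 ht) x) v
  have eψ := congrFun (congrFun (hψ.eq_linearBoltzmannSeries hβ hα0 ht) x) v
  -- the two contractions
  have h1 : |φ (α * τ) x v - ψ (α * τ) x v| ≤ δ := by
    rw [eφ, eψ]
    exact abs_linearBoltzmannSeries_sub_le hβ hα0 hρ₀ hp.continuous hρ₀0 hp0 hpρ _ x v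
  have h2 : |torusHeatSolution (bgsrDiffusionCoeff β b) p τ x -
      torusHeatSolution (bgsrDiffusionCoeff β b) ρ₀ τ x| ≤ δ := by
    rw [abs_sub_comm]
    exact abs_torusHeatSolution_sub_le _ hρ₀ hp.continuous hpρ τ x
  -- assembly
  have hMv := (maxwellianBeta_pos hβ v).le
  have htri : |φ (α * τ) x v - torusHeatSolution (bgsrDiffusionCoeff β b) ρ₀ τ x| ≤
      |φ (α * τ) x v - ψ (α * τ) x v| +
        |ψ (α * τ) x v - torusHeatSolution (bgsrDiffusionCoeff β b) p τ x| +
        |torusHeatSolution (bgsrDiffusionCoeff β b) p τ x -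
          torusHeatSolution (bgsrDiffusionCoeff β b) ρ₀ τ x| :=
    (abs_sub_le _ _ _).trans (add_le_add (abs_sub_le _ _ _) le_rfl)
  calc maxwellianBeta β v * |φ (α * τ) x v - torusHeatSolution (bgsrDiffusionCoeff β b) ρ₀ τ x|
      ≤ maxwellianBeta β v * (|φ (α * τ) x v - ψ (α * τ) x v| +
          |ψ (α * τ) x v - torusHeatSolution (bgsrDiffusionCoeff β b) p τ x| +
          |torusHeatSolution (bgsrDiffusionCoeff β b) p τ x -
            torusHeatSolution (bgsrDiffusionCoeff β b) ρ₀ τ x|) :=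
        mul_le_mul_of_nonneg_left htri hMv
    _ = maxwellianBeta β v * |φ (α * τ) x v - ψ (α * τ) x v| +
          maxwellianBeta β v * |ψ (α * τ) x v - torusHeatSolution (bgsrDiffusionCoeff β b) p τ x| +
          maxwellianBeta β v * |torusHeatSolution (bgsrDiffusionCoeff β b) p τ x -
            torusHeatSolution (bgsrDiffusionCoeff β b) ρ₀ τ x| := by ring
    _ ≤ M₀ * δ + e / 2 + M₀ * δ :=
        add_le_add (add_le_add (mul_le_mul (hMle v) h1 (abs_nonneg _) hM₀.le) key)
          (mul_le_mul (hMle v) h2 (abs_nonneg _) hM₀.le)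
    _ = e := by
        rw [hδ_def]
        field_simp
        ring

/-! ## Second layer: from trigonometric polynomials to single Fourier modes

A real trigonometric polynomial is a finite real combination of the constant `1` and of the
single-mode functions `cos(2π n·x)`, `sin(2π n·x)`, `n ≠ 0`; both solution maps (the collision
series of (1.3) and the heat flow) are additive and positively homogeneous in nonnegative data and
fix constants, so (6.3) for trigonometric-polynomial probability densities follows from (6.3) for
the *elementary single-mode densities* `1 + a₁ cos(2π n·x) + a₂ sin(2π n·x)`, `|a₁| + |a₂| ≤ 1`,
`n ≠ 0` (`bgsr_hydrodynamicLimit_mode`), by writing `ρ⁰ = K + ∑ λ_n ρ_n` with `λ_n ≥ 0` and a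
real constant `K` and moving `K⁻` to the other side. -/

/-- The Fourier monomials have modulus one pointwise. [folklore] -/
theorem norm_mFourier_apply (n : d → ℤ) (x : 𝕋) : ‖UnitAddTorus.mFourier n x‖ = 1 := by
  simp only [UnitAddTorus.mFourier, fourier_apply, ContinuousMap.coe_mk, norm_prod,
    Circle.norm_coe, Finset.prod_const_one]

/-- `|cos(2π n·x)| ≤ 1`. [folklore] -/
theorem abs_re_mFourier_le (n : d → ℤ) (x : 𝕋) : |(UnitAddTorus.mFourier n x).re| ≤ 1 :=
  (Complex.abs_re_le_norm _).trans_eq (norm_mFourier_apply n x)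

/-- `|sin(2π n·x)| ≤ 1`. [folklore] -/
theorem abs_im_mFourier_le (n : d → ℤ) (x : 𝕋) : |(UnitAddTorus.mFourier n x).im| ≤ 1 :=
  (Complex.abs_im_le_norm _).trans_eq (norm_mFourier_apply n x)

/-- The *elementary single-mode densities* on `T^d`:
`ρ_{n,a₁,a₂}(x) = 1 + a₁ cos(2π n·x) + a₂ sin(2π n·x)` (real and imaginary parts of the Fourier
monomial `e_n`); for `|a₁| + |a₂| ≤ 1` and `n ≠ 0` a trigonometric-polynomial probability density.
[folklore] -/
def modeDensity (n : d → ℤ) (a₁ a₂ : ℝ) (x : 𝕋) : ℝ :=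
  1 + a₁ * (UnitAddTorus.mFourier n x).re + a₂ * (UnitAddTorus.mFourier n x).im

/-- Unfolding of `modeDensity`. [folklore] -/
theorem modeDensity_apply (n : d → ℤ) (a₁ a₂ : ℝ) (x : 𝕋) :
    modeDensity n a₁ a₂ x =
      1 + a₁ * (UnitAddTorus.mFourier n x).re + a₂ * (UnitAddTorus.mFourier n x).im :=
  rfl

/-- The elementary densities are continuous. [folklore] -/
theorem continuous_modeDensity (n : d → ℤ) (a₁ a₂ : ℝ) : Continuous (modeDensity (d := d) n a₁ a₂) := by
  unfold modeDensity
  have hc := (UnitAddTorus.mFourier (d := d) n).continuous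
  fun_prop

/-- The elementary densities are nonnegative when `|a₁| + |a₂| ≤ 1`. [folklore] -/
theorem modeDensity_nonneg (n : d → ℤ) {a₁ a₂ : ℝ} (ha : |a₁| + |a₂| ≤ 1) (x : 𝕋) :
    0 ≤ modeDensity n a₁ a₂ x := by
  have h1 : -|a₁| ≤ a₁ * (UnitAddTorus.mFourier n x).re := by
    have := neg_abs_le (a₁ * (UnitAddTorus.mFourier n x).re)
    rw [abs_mul] at this
    nlinarith [abs_re_mFourier_le n x, abs_nonneg a₁, abs_nonneg (UnitAddTorus.mFourier n x).re]
  have h2 : -|a₂| ≤ a₂ * (UnitAddTorus.mFourier n x).im := by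
    have := neg_abs_le (a₂ * (UnitAddTorus.mFourier n x).im)
    rw [abs_mul] at this
    nlinarith [abs_im_mFourier_le n x, abs_nonneg a₂, abs_nonneg (UnitAddTorus.mFourier n x).im]
  unfold modeDensity
  linarith

/-- The elementary densities are bounded by `2` in absolute value when `|a₁| + |a₂| ≤ 1`.
[folklore] -/
theorem abs_modeDensity_le (n : d → ℤ) {a₁ a₂ : ℝ} (ha : |a₁| + |a₂| ≤ 1) (x : 𝕋) :
    |modeDensity n a₁ a₂ x| ≤ 2 := by
  have h1 : |a₁ * (UnitAddTorus.mFourier n x).re| ≤ |a₁| := by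
    rw [abs_mul]; exact mul_le_of_le_one_right (abs_nonneg _) (abs_re_mFourier_le n x)
  have h2 : |a₂ * (UnitAddTorus.mFourier n x).im| ≤ |a₂| := by
    rw [abs_mul]; exact mul_le_of_le_one_right (abs_nonneg _) (abs_im_mFourier_le n x)
  unfold modeDensity
  calc |1 + a₁ * (UnitAddTorus.mFourier n x).re + a₂ * (UnitAddTorus.mFourier n x).im|
      ≤ |1 + a₁ * (UnitAddTorus.mFourier n x).re| + |a₂ * (UnitAddTorus.mFourier n x).im| :=
        abs_add_le _ _
    _ ≤ |(1 : ℝ)| + |a₁ * (UnitAddTorus.mFourier n x).re| + |a₂ * (UnitAddTorus.mFourier n x).im| :=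
        add_le_add (abs_add_le _ _) le_rfl
    _ ≤ 1 + |a₁| + |a₂| := by rw [abs_one]; linarith
    _ ≤ 2 := by linarith

/-- The elementary densities are real trigonometric polynomials
(`cos = (e_n + ē_n)/2`, `sin = (e_n - ē_n)/(2i)`, `ē_n = e_{-n}`). [folklore] -/
theorem isRealTrigPoly_modeDensity (n : d → ℤ) (a₁ a₂ : ℝ) : IsRealTrigPoly (modeDensity (d := d) n a₁ a₂) := by
  have hn : UnitAddTorus.mFourier n ∈ Submodule.span ℂ (Set.range (UnitAddTorus.mFourier (d := d))) :=
    Submodule.subset_span ⟨n, rfl⟩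
  have h0 : UnitAddTorus.mFourier 0 ∈ Submodule.span ℂ (Set.range (UnitAddTorus.mFourier (d := d))) :=
    Submodule.subset_span ⟨0, rfl⟩
  refine ⟨UnitAddTorus.mFourier 0 +
      (a₁ : ℂ) • ((2⁻¹ : ℂ) • (UnitAddTorus.mFourier n + star (UnitAddTorus.mFourier n))) +
      (a₂ : ℂ) • ((2 * Complex.I)⁻¹ • (UnitAddTorus.mFourier n - star (UnitAddTorus.mFourier n))),
    Submodule.add_mem _ (Submodule.add_mem _ h0 (Submodule.smul_mem _ _ (Submodule.smul_mem _ _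
      (Submodule.add_mem _ hn (star_mem_span_mFourier hn)))))
      (Submodule.smul_mem _ _ (Submodule.smul_mem _ _
        (Submodule.sub_mem _ hn (star_mem_span_mFourier hn)))), fun x => ?_⟩
  simp only [modeDensity, ContinuousMap.coe_add, ContinuousMap.coe_smul, ContinuousMap.coe_sub,
    Pi.add_apply, Pi.smul_apply, Pi.sub_apply, ContinuousMap.star_apply, smul_eq_mul,
    Complex.star_def, UnitAddTorus.mFourier_zero, ContinuousMap.one_apply]
  push_cast
  rw [Complex.re_eq_add_conj, Complex.im_eq_sub_conj]
  have hI : (2 : ℂ) * Complex.I ≠ 0 := mul_ne_zero two_ne_zero Complex.I_ne_zero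
  field_simp

/-- Shifting the `i`-th coordinate by half a period of the `i`-th factor flips the sign of the
Fourier monomial (`n i ≠ 0`). [folklore] -/
theorem mFourier_add_single_half [DecidableEq d] {n : d → ℤ} {i : d} (hi : n i ≠ 0) (x : 𝕋) :
    UnitAddTorus.mFourier n (x + Pi.single i (((1 : ℝ) / 2 / (n i) : ℝ) : UnitAddCircle)) =
      -UnitAddTorus.mFourier n x := by
  simp only [UnitAddTorus.mFourier, ContinuousMap.coe_mk]
  rw [← Finset.mul_prod_erase Finset.univ _ (Finset.mem_univ i),
    ← Finset.mul_prod_erase Finset.univ (fun j => (fourier (n j) (x j) : ℂ)) (Finset.mem_univ i)]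
  rw [Pi.add_apply, Pi.single_eq_same, fourier_add_half_inv_index hi one_pos, neg_mul]
  congr 2
  refine Finset.prod_congr rfl fun j hj => ?_
  rw [Pi.add_apply, Pi.single_eq_of_ne (Finset.ne_of_mem_erase hj), add_zero]

/-- **Non-constant Fourier monomials have zero mean on `T^d`** (translation by half a period in
a coordinate where `n i ≠ 0` flips the sign; Lebesgue measure on the torus is translation
invariant). [cite: Grafakos2014, §3.1] -/
theorem integral_mFourier_eq_zero {n : d → ℤ} (hn : n ≠ 0) :
    ∫ x : 𝕋, UnitAddTorus.mFourier n x = 0 := by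
  classical
  obtain ⟨i, hi⟩ : ∃ i, n i ≠ 0 := Function.ne_iff.1 hn
  exact integral_eq_zero_of_add_right_eq_neg (mFourier_add_single_half hi)

/-- `∫ cos(2π n·x) dx = 0` for `n ≠ 0`. [folklore] -/
theorem integral_re_mFourier_eq_zero {n : d → ℤ} (hn : n ≠ 0) :
    ∫ x : 𝕋, (UnitAddTorus.mFourier n x).re = 0 := by
  have h := integral_re (𝕜 := ℂ) (μ := (volume : Measure 𝕋))
    (f := fun x => UnitAddTorus.mFourier n x) (UnitAddTorus.mFourier n).continuous.integrable_unitAddTorus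
  simp only [RCLike.re_to_complex] at h
  rw [h, integral_mFourier_eq_zero hn, Complex.zero_re]

/-- `∫ sin(2π n·x) dx = 0` for `n ≠ 0`. [folklore] -/
theorem integral_im_mFourier_eq_zero {n : d → ℤ} (hn : n ≠ 0) :
    ∫ x : 𝕋, (UnitAddTorus.mFourier n x).im = 0 := by
  have h := integral_im (𝕜 := ℂ) (μ := (volume : Measure 𝕋))
    (f := fun x => UnitAddTorus.mFourier n x) (UnitAddTorus.mFourier n).continuous.integrable_unitAddTorus
  simp only [RCLike.im_to_complex] at h
  rw [h, integral_mFourier_eq_zero hn, Complex.zero_im]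

/-- The elementary densities have unit mass for `n ≠ 0`. [folklore] -/
theorem integral_modeDensity {n : d → ℤ} (hn : n ≠ 0) (a₁ a₂ : ℝ) :
    ∫ x, modeDensity (d := d) n a₁ a₂ x = 1 := by
  unfold modeDensity
  have hre : Integrable fun x : 𝕋 => (UnitAddTorus.mFourier n x).re :=
    (Complex.continuous_re.comp (UnitAddTorus.mFourier n).continuous).integrable_unitAddTorus
  have him : Integrable fun x : 𝕋 => (UnitAddTorus.mFourier n x).im :=
    (Complex.continuous_im.comp (UnitAddTorus.mFourier n).continuous).integrable_unitAddTorus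
  have h1 : Integrable (fun x : 𝕋 => (1 : ℝ) + a₁ * (UnitAddTorus.mFourier n x).re) :=
    (integrable_const _).add (hre.const_mul _)
  have h2 : Integrable (fun x : 𝕋 => a₂ * (UnitAddTorus.mFourier n x).im) := him.const_mul _
  have h3 : Integrable (fun x : 𝕋 => a₁ * (UnitAddTorus.mFourier n x).re) := hre.const_mul _
  rw [integral_add h1 h2, integral_add (integrable_const _) h3, integral_const_mul, integral_const_mul,
    integral_re_mFourier_eq_zero hn, integral_im_mFourier_eq_zero hn, integral_const_unitAddTorus]
  ring

/-! ### Linearity of the two flows over nonnegative combinations -/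

/-- The collision series with datum `0` vanishes. [folklore] -/
theorem linearBoltzmannSeries_zero_datum (β α t : ℝ) (x : 𝕋) (v : 𝔼) :
    linearBoltzmannSeries (Literature.Analysis.FluidPDE.Torus.geometry d) β α (fun _ _ => (0 : ℝ)) t x v = 0 := by
  simpa using linearBoltzmannSeries_const_mul (Literature.Analysis.FluidPDE.Torus.geometry d) β α 0
    (fun _ _ => (1 : ℝ)) t x v

/-- Additivity of the collision series over nonnegative continuous torus data. [folklore] -/
theorem linearBoltzmannSeries_add_torus {β α : ℝ} (hβ : 0 < β) (hα : 0 ≤ α) {f g : 𝕋 → ℝ}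
    (hf : Continuous f) (hg : Continuous g) (hf0 : ∀ x, 0 ≤ f x) (hg0 : ∀ x, 0 ≤ g x)
    (t : ℝ) (x : 𝕋) (v : 𝔼) :
    linearBoltzmannSeries (Literature.Analysis.FluidPDE.Torus.geometry d) β α (fun x _ => f x + g x) t x v =
      linearBoltzmannSeries (Literature.Analysis.FluidPDE.Torus.geometry d) β α (fun x _ => f x) t x v +
        linearBoltzmannSeries (Literature.Analysis.FluidPDE.Torus.geometry d) β α (fun x _ => g x) t x v := by
  obtain ⟨Rf, hRf⟩ := exists_upper_bound_of_continuous hf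
  obtain ⟨Rg, hRg⟩ := exists_upper_bound_of_continuous hg
  exact linearBoltzmannSeries_add (linearBoltzmannData_torus (d := d) hβ hα hf hf0 hRf)
    (linearBoltzmannData_torus (d := d) hβ hα hg hg0 hRg) t x v

/-- The collision series with a nonnegative constant datum is that constant. [folklore] -/
theorem linearBoltzmannSeries_const_torus {β α : ℝ} (hβ : 0 < β) (hα : 0 ≤ α) (c t : ℝ)
    (x : 𝕋) (v : 𝔼) :
    linearBoltzmannSeries (Literature.Analysis.FluidPDE.Torus.geometry d) β α (fun _ _ => c) t x v = c :=
  linearBoltzmannSeries_const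
    (linearBoltzmannData_torus (d := d) hβ hα (continuous_const (y := (0 : ℝ))) (fun _ => le_rfl)
      (fun _ => le_rfl)).continuous_translate hβ hα c t x v

/-- **Linearity of the collision series over nonnegative combinations** of nonnegative
continuous torus data: `φ[∑ λ_i f_i] = ∑ λ_i φ[f_i]` for `λ_i ≥ 0`. [folklore] -/
theorem linearBoltzmannSeries_finset_sum {β α : ℝ} (hβ : 0 < β) (hα : 0 ≤ α) {ι : Type*}
    (S : Finset ι) {f : ι → 𝕋 → ℝ} (hf : ∀ i, Continuous (f i)) (hf0 : ∀ i x, 0 ≤ f i x)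
    {c : ι → ℝ} (hc : ∀ i, 0 ≤ c i) (t : ℝ) (x : 𝕋) (v : 𝔼) :
    linearBoltzmannSeries (Literature.Analysis.FluidPDE.Torus.geometry d) β α (fun x _ => ∑ i ∈ S, c i * f i x) t x v =
      ∑ i ∈ S, c i *
        linearBoltzmannSeries (Literature.Analysis.FluidPDE.Torus.geometry d) β α (fun x _ => f i x) t x v := by
  classical
  induction S using Finset.induction_on with
  | empty =>
    simp only [Finset.sum_empty]
    exact linearBoltzmannSeries_zero_datum β α t x v
  | insert a S ha ih =>
    simp only [Finset.sum_insert ha]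
    rw [← ih, ← linearBoltzmannSeries_const_mul]
    exact linearBoltzmannSeries_add_torus hβ hα ((hf a).const_smul (c a) |>.congr fun _ => rfl)
      (continuous_finsetSum _ fun i _ => (hf i).const_smul (c i) |>.congr fun _ => rfl)
      (fun y => mul_nonneg (hc a) (hf0 a y))
      (fun y => Finset.sum_nonneg fun i _ => mul_nonneg (hc i) (hf0 i y)) t x v

/-- The heat flow of a constant is the constant. [folklore] -/
theorem torusHeatSolution_const (κ c τ : ℝ) (x : 𝕋) :
    torusHeatSolution (d := d) κ (fun _ => c) τ x = c := by
  simp [torusHeatSolution]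

/-- Additivity of the heat flow in the (continuous) datum. [folklore] -/
theorem torusHeatSolution_add (κ : ℝ) {f g : 𝕋 → ℝ} (hf : Continuous f) (hg : Continuous g)
    (τ : ℝ) (x : 𝕋) :
    torusHeatSolution κ (fun y => f y + g y) τ x =
      torusHeatSolution κ f τ x + torusHeatSolution κ g τ x := by
  unfold torusHeatSolution
  rw [← integral_add (integrable_torusHeat_integrand κ hf τ x) (integrable_torusHeat_integrand κ hg τ x)]

/-- Homogeneity of the heat flow in the datum. [folklore] -/
theorem torusHeatSolution_const_mul (κ c : ℝ) (f : 𝕋 → ℝ) (τ : ℝ) (x : 𝕋) :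
    torusHeatSolution κ (fun y => c * f y) τ x = c * torusHeatSolution κ f τ x := by
  unfold torusHeatSolution
  exact integral_const_mul _ _

/-- **Linearity of the heat flow over finite combinations** of continuous data. [folklore] -/
theorem torusHeatSolution_finset_sum (κ : ℝ) {ι : Type*} (S : Finset ι) {f : ι → 𝕋 → ℝ}
    (hf : ∀ i, Continuous (f i)) (c : ι → ℝ) (τ : ℝ) (x : 𝕋) :
    torusHeatSolution κ (fun y => ∑ i ∈ S, c i * f i y) τ x =
      ∑ i ∈ S, c i * torusHeatSolution κ (f i) τ x := by
  classical
  induction S using Finset.induction_on with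
  | empty =>
    simp only [Finset.sum_empty]
    exact torusHeatSolution_const κ 0 τ x
  | insert a S ha ih =>
    simp only [Finset.sum_insert ha]
    rw [← ih, ← torusHeatSolution_const_mul]
    exact torusHeatSolution_add κ ((hf a).const_smul (c a) |>.congr fun _ => rfl)
      (continuous_finsetSum _ fun i _ => (hf i).const_smul (c i) |>.congr fun _ => rfl) τ x

/-! ### Decomposition of a real trigonometric polynomial into elementary densities -/

/-- The coefficient weight `λ = |Re c| + |Im c|` of a Fourier coefficient. [folklore] -/
def modeWeight (c : ℂ) : ℝ := |c.re| + |c.im|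

/-- Unfolding of `modeWeight`. [folklore] -/
theorem modeWeight_def (c : ℂ) : modeWeight c = |c.re| + |c.im| := rfl

/-- `λ ≥ 0`. [folklore] -/
theorem modeWeight_nonneg (c : ℂ) : 0 ≤ modeWeight c := add_nonneg (abs_nonneg _) (abs_nonneg _)

/-- The normalised coefficients of an elementary density satisfy `|a₁| + |a₂| ≤ 1`. [folklore] -/
theorem modeWeight_coeff_le (c : ℂ) :
    |c.re / modeWeight c| + |-c.im / modeWeight c| ≤ 1 := by
  by_cases h : modeWeight c = 0
  · simp [h]
  have hpos : 0 < modeWeight c := lt_of_le_of_ne (modeWeight_nonneg c) (Ne.symm h)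
  rw [abs_div, abs_div, abs_neg, abs_of_pos hpos, ← add_div, div_le_one hpos]
  exact le_rfl

/-- **One Fourier mode as a multiple of an elementary density minus its constant**:
`Re(c e_n(x)) = λ (ρ_{n, Re c/λ, -Im c/λ}(x) - 1)`, `λ = |Re c| + |Im c|` (also when `λ = 0`).
[folklore] -/
theorem re_coeff_mul_mFourier (c : ℂ) (n : d → ℤ) (x : 𝕋) :
    (c * UnitAddTorus.mFourier n x).re =
      modeWeight c * (modeDensity n (c.re / modeWeight c) (-c.im / modeWeight c) x - 1) := by
  rw [Complex.mul_re, modeDensity]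
  by_cases h : modeWeight c = 0
  · have h1 : c.re = 0 :=
      abs_eq_zero.1 (by unfold modeWeight at h; linarith [abs_nonneg c.re, abs_nonneg c.im])
    have h2 : c.im = 0 :=
      abs_eq_zero.1 (by unfold modeWeight at h; linarith [abs_nonneg c.re, abs_nonneg c.im])
    simp [h, h1, h2]
  · field_simp
    ring

/-- **Decomposition of a trigonometric-polynomial datum**: a real trigonometric polynomial is
`K + ∑_{n ∈ S} λ_n ρ_n` with `S` a finite set of nonzero frequencies, weights `λ_n ≥ 0`,
elementary densities `ρ_n = modeDensity n a₁ a₂` with `|a₁| + |a₂| ≤ 1`, and a real constant `K`.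
[folklore] -/
theorem IsRealTrigPoly.exists_decomposition {ρ : 𝕋 → ℝ} (hρ : IsRealTrigPoly ρ) :
    ∃ (S : Finset (d → ℤ)) (w : (d → ℤ) → ℝ) (a₁ a₂ : (d → ℤ) → ℝ) (K : ℝ),
      (0 : d → ℤ) ∉ S ∧ (∀ n, 0 ≤ w n) ∧ (∀ n, |a₁ n| + |a₂ n| ≤ 1) ∧
      ∀ x, ρ x = K + ∑ n ∈ S, w n * modeDensity n (a₁ n) (a₂ n) x := by
  classical
  obtain ⟨P, hP, hPρ⟩ := hρ
  obtain ⟨c, hc⟩ := Finsupp.mem_span_range_iff_exists_finsupp.1 hP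
  -- pointwise form of `P`
  have hPx : ∀ x, P x = ∑ n ∈ c.support, c n * UnitAddTorus.mFourier n x := fun x => by
    rw [← hc]
    simp [Finsupp.sum, ContinuousMap.coe_sum, Finset.sum_apply]
  have hρx : ∀ x, ρ x = ∑ n ∈ c.support, (c n * UnitAddTorus.mFourier n x).re := fun x => by
    have h1 : ρ x = (P x).re := by rw [← hPρ x, Complex.ofReal_re]
    rw [h1, hPx, Complex.re_sum]
  refine ⟨c.support.erase 0, fun n => modeWeight (c n), fun n => (c n).re / modeWeight (c n),
    fun n => -(c n).im / modeWeight (c n), (c 0).re - ∑ n ∈ c.support.erase 0, modeWeight (c n),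
    Finset.notMem_erase _ _, fun n => modeWeight_nonneg _, fun n => modeWeight_coeff_le _,
    fun x => ?_⟩
  -- split off the frequency `0`
  have hsplit : ∑ n ∈ c.support, (c n * UnitAddTorus.mFourier n x).re =
      (c 0).re + ∑ n ∈ c.support.erase 0, (c n * UnitAddTorus.mFourier n x).re := by
    have e0 : (c 0 * UnitAddTorus.mFourier 0 x).re = (c 0).re := by
      simp [UnitAddTorus.mFourier_zero]
    by_cases h0 : (0 : d → ℤ) ∈ c.support
    · rw [← Finset.add_sum_erase _ _ h0, e0]
    · have hc0 : c 0 = 0 := Finsupp.notMem_support_iff.1 h0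
      rw [Finset.erase_eq_of_notMem h0, hc0, Complex.zero_re, zero_add]
  rw [hρx, hsplit]
  simp_rw [re_coeff_mul_mFourier, mul_sub, Finset.sum_sub_distrib, mul_one]
  ring

/-! ### The single-mode sub-fact and the reduction -/

/-- **BGSR (6.3) for a single Fourier mode** (the elementary case of the smooth-data statement of
§6.1.1): verbatim `bgsr_hydrodynamicLimit` / `bgsr_hydrodynamicLimit_trigPoly` — `d ≥ 2`,
`β > 0`, a corrector `b` of (6.5) fixing `κ_β` (6.8), `T > 0`, `e > 0`, a threshold `α₀` beyond
which every solution `φ` of (1.3) with rate `α` in the class `IsTaggedLinearBoltzmannSolution`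
satisfies `M_β(v) |φ(ατ, x, v) - ρ(τ, x)| ≤ e` on `[0, T] × T^d × ℝ^d` — for the initial datum
`ρ⁰ = ρ_{n,a₁,a₂} = 1 + a₁ cos(2π n·x) + a₂ sin(2π n·x)` (`modeDensity`), `n ∈ ℤ^d ∖ {0}`,
`|a₁| + |a₂| ≤ 1` (a trigonometric-polynomial probability density: `isRealTrigPoly_modeDensity`,
`modeDensity_nonneg`, `integral_modeDensity`). For such data the heat flow is explicit,
`ρ(τ, x) = 1 + e^{-4π² κ_β |n|² τ} (a₁ cos + a₂ sin)(2π n·x)`, and by translation covariance and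
uniqueness the solution separates as `1 + Re((a₁ - i a₂) e_n(x) ĝ_n(t, v))`; what remains is the
velocity-only relaxation `M_β(v) |ĝ_n(ατ, v) - e^{-4π² κ_β |n|² τ}| → 0` uniformly on
`[0, T] × ℝ^d` (Hilbert expansion with the correctors (6.5), (6.7)). Implies the general (6.3)
(`bgsr_hydrodynamicLimit_of_mode`).
[cite: BodineauGallagherSaintRaymondInvent2016, (6.3) and §6.1.1] -/
def bgsr_hydrodynamicLimit_mode : Prop :=
  ∀ (hd : 2 ≤ Fintype.card d) {β : ℝ} (hβ : 0 < β) (b : 𝔼 → 𝔼) (hb : IsDiffusionCorrector β b)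
    (n : d → ℤ) (hn : n ≠ 0) (a₁ a₂ : ℝ) (ha : |a₁| + |a₂| ≤ 1)
    {T : ℝ} (hT : 0 < T) {e : ℝ} (he : 0 < e),
    ∃ α₀ : ℝ, ∀ α : ℝ, α₀ ≤ α → ∀ φ : ℝ → 𝕋 → 𝔼 → ℝ,
      IsTaggedLinearBoltzmannSolution β α (modeDensity n a₁ a₂) φ →
      ∀ τ ∈ Icc 0 T, ∀ (x : 𝕋) (v : 𝔼),
        maxwellianBeta β v *
          |φ (α * τ) x v - torusHeatSolution (bgsrDiffusionCoeff β b) (modeDensity n a₁ a₂) τ x| ≤ e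

/-- The single-mode case is a special case of the trigonometric-polynomial case. [folklore] -/
theorem bgsr_hydrodynamicLimit_mode_of (h : bgsr_hydrodynamicLimit_trigPoly (d := d)) :
    bgsr_hydrodynamicLimit_mode (d := d) :=
  fun hd _ hβ b hb n hn a₁ a₂ ha _ hT _ he =>
    h hd hβ b hb (modeDensity n a₁ a₂) (isRealTrigPoly_modeDensity n a₁ a₂) (modeDensity_nonneg n ha)
      (integral_modeDensity hn a₁ a₂) hT he

/-- **(6.3) for trigonometric-polynomial data from the single-mode case.** Decompose the datum as
`ρ⁰ = K + ∑_{n ∈ S} λ_n ρ_n` (`IsRealTrigPoly.exists_decomposition`); since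
`ρ⁰ + K⁻ = K⁺ + ∑ λ_n ρ_n` with all data nonnegative, linearity of both flows over nonnegative
combinations (`linearBoltzmannSeries_finset_sum`, `torusHeatSolution_finset_sum`; constants are
fixed) gives `φ[ρ⁰](ατ) - ρ[ρ⁰](τ) = ∑ λ_n (φ[ρ_n](ατ) - ρ[ρ_n](τ))`, and the single-mode statement
at accuracy `e / (∑ λ_n + 1)` beyond the largest of the finitely many thresholds concludes.
[cite: BodineauGallagherSaintRaymondInvent2016, (6.3) and §6.1.1] -/
theorem bgsr_hydrodynamicLimit_trigPoly_of_mode (h : bgsr_hydrodynamicLimit_mode (d := d)) :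
    bgsr_hydrodynamicLimit_trigPoly (d := d) := by
  intro hd β hβ b hb ρ₀ hρ₀ hρ₀0 hρ₀1 T hT e he
  obtain ⟨S, w, a₁, a₂, K, h0S, hw, ha, hdec⟩ := hρ₀.exists_decomposition
  set G := Literature.Analysis.FluidPDE.Torus.geometry d with hG
  set κ := bgsrDiffusionCoeff β b with hκ
  -- accuracy per mode and the thresholds
  set Λ : ℝ := ∑ n ∈ S, w n with hΛ
  have hΛ0 : 0 ≤ Λ := Finset.sum_nonneg fun n _ => hw n
  set e' : ℝ := e / (Λ + 1) with he'
  have he'0 : 0 < e' := by positivity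
  have hmode : ∀ n, n ∈ S → ∃ α₀ : ℝ, ∀ α : ℝ, α₀ ≤ α → ∀ φ : ℝ → 𝕋 → 𝔼 → ℝ,
      IsTaggedLinearBoltzmannSolution β α (modeDensity n (a₁ n) (a₂ n)) φ →
      ∀ τ ∈ Icc 0 T, ∀ (x : 𝕋) (v : 𝔼),
        maxwellianBeta β v *
          |φ (α * τ) x v - torusHeatSolution κ (modeDensity n (a₁ n) (a₂ n)) τ x| ≤ e' :=
    fun n hn => h hd hβ b hb n (fun h0 => h0S (h0 ▸ hn)) (a₁ n) (a₂ n) (ha n) hT he'0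
  choose! A hA using hmode
  refine ⟨max 0 (∑ n ∈ S, |A n|), fun α hα φ hφ τ hτ x v => ?_⟩
  have hα0 : 0 ≤ α := le_of_max_le_left hα
  have hαA : ∀ n ∈ S, A n ≤ α := fun n hn =>
    ((le_abs_self _).trans (Finset.single_le_sum (fun m _ => abs_nonneg (A m)) hn)).trans
      (le_of_max_le_right hα)
  have ht : 0 ≤ α * τ := mul_nonneg hα0 hτ.1
  -- the mode solutions
  set ψ : (d → ℤ) → ℝ → 𝕋 → 𝔼 → ℝ := fun n =>
    linearBoltzmannSeries G β α (fun x _ => modeDensity n (a₁ n) (a₂ n) x) with hψ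
  have hψsol : ∀ n, IsTaggedLinearBoltzmannSolution β α (modeDensity n (a₁ n) (a₂ n)) (ψ n) :=
    fun n => (isTaggedLinearBoltzmannSolution_linearBoltzmannSeries hβ hα0
      (continuous_modeDensity n (a₁ n) (a₂ n)) (modeDensity_nonneg n (ha n))
      (fun x => (abs_le.1 (abs_modeDensity_le n (ha n) x)).2)).1
  have hbound : ∀ n ∈ S, maxwellianBeta β v *
      |ψ n (α * τ) x v - torusHeatSolution κ (modeDensity n (a₁ n) (a₂ n)) τ x| ≤ e' :=
    fun n hn => hA n hn α (hαA n hn) (ψ n) (hψsol n) τ hτ x v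
  -- linearity: `φ(ατ) = K + ∑ λ_n ψ_n(ατ)` and `ρ(τ) = K + ∑ λ_n ρ_n(τ)`
  have hcont : Continuous fun y => ∑ n ∈ S, w n * modeDensity n (a₁ n) (a₂ n) y :=
    continuous_finsetSum _ fun n _ => (continuous_modeDensity n (a₁ n) (a₂ n)).const_smul (w n)
      |>.congr fun _ => rfl
  have hnonneg : ∀ y, 0 ≤ ∑ n ∈ S, w n * modeDensity n (a₁ n) (a₂ n) y := fun y =>
    Finset.sum_nonneg fun n _ => mul_nonneg (hw n) (modeDensity_nonneg n (ha n) y)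
  have hKpm : max K 0 - max (-K) 0 = K := by
    rcases le_total 0 K with hK | hK
    · rw [max_eq_left hK, max_eq_right (by linarith), sub_zero]
    · rw [max_eq_right hK, max_eq_left (by linarith)]; ring
  have hρK : ∀ y, ρ₀ y + max (-K) 0 = max K 0 + ∑ n ∈ S, w n * modeDensity n (a₁ n) (a₂ n) y :=
    fun y => by rw [hdec y]; linarith [hKpm]
  have hφ_eq : φ (α * τ) x v = K + ∑ n ∈ S, w n * ψ n (α * τ) x v := by
    have e1 := congrFun (congrFun (hφ.eq_linearBoltzmannSeries hβ hα0 ht) x) v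
    -- `φ[ρ⁰] + K⁻ = φ[ρ⁰ + K⁻] = φ[K⁺ + ∑] = K⁺ + ∑ λ_n ψ_n`
    have e2 := linearBoltzmannSeries_add_torus hβ hα0 hρ₀.continuous (continuous_const (y := max (-K) 0))
      hρ₀0 (fun _ => le_max_right _ _) (α * τ) x v
    have e3 := linearBoltzmannSeries_add_torus hβ hα0 (continuous_const (y := max K 0)) hcont
      (fun _ => le_max_right _ _) hnonneg (α * τ) x v
    have e4 : (fun (y : 𝕋) (_ : 𝔼) => ρ₀ y + max (-K) 0) = fun (y : 𝕋) (_ : 𝔼) =>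
        max K 0 + ∑ n ∈ S, w n * modeDensity n (a₁ n) (a₂ n) y := by
      funext y w'; exact hρK y
    rw [e4, e3, linearBoltzmannSeries_const_torus hβ hα0, linearBoltzmannSeries_const_torus hβ hα0,
      linearBoltzmannSeries_finset_sum hβ hα0 S (fun n => continuous_modeDensity n (a₁ n) (a₂ n))
        (fun n y => modeDensity_nonneg n (ha n) y) hw] at e2
    rw [e1]
    linarith [hKpm]
  have hρ_eq : torusHeatSolution κ ρ₀ τ x =
      K + ∑ n ∈ S, w n * torusHeatSolution κ (modeDensity n (a₁ n) (a₂ n)) τ x := by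
    have e2 := torusHeatSolution_add κ hρ₀.continuous (continuous_const (y := max (-K) 0)) τ x
    have e3 := torusHeatSolution_add κ (continuous_const (y := max K 0)) hcont τ x
    have e4 : (fun y : 𝕋 => ρ₀ y + max (-K) 0) = fun y : 𝕋 =>
        max K 0 + ∑ n ∈ S, w n * modeDensity n (a₁ n) (a₂ n) y := funext hρK
    rw [e4, e3, torusHeatSolution_const, torusHeatSolution_const,
      torusHeatSolution_finset_sum κ S (fun n => continuous_modeDensity n (a₁ n) (a₂ n)) w] at e2
    linarith [hKpm]
  -- the estimate
  have hMv := (maxwellianBeta_pos hβ v).le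
  have hdiff : φ (α * τ) x v - torusHeatSolution κ ρ₀ τ x =
      ∑ n ∈ S, w n * (ψ n (α * τ) x v - torusHeatSolution κ (modeDensity n (a₁ n) (a₂ n)) τ x) := by
    rw [hφ_eq, hρ_eq]
    simp only [mul_sub, Finset.sum_sub_distrib]
    ring
  calc maxwellianBeta β v * |φ (α * τ) x v - torusHeatSolution κ ρ₀ τ x|
      = maxwellianBeta β v * |∑ n ∈ S, w n *
          (ψ n (α * τ) x v - torusHeatSolution κ (modeDensity n (a₁ n) (a₂ n)) τ x)| := by rw [hdiff]
    _ ≤ maxwellianBeta β v * ∑ n ∈ S, |w n *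
          (ψ n (α * τ) x v - torusHeatSolution κ (modeDensity n (a₁ n) (a₂ n)) τ x)| :=
        mul_le_mul_of_nonneg_left (Finset.abs_sum_le_sum_abs _ _) hMv
    _ = ∑ n ∈ S, w n * (maxwellianBeta β v *
          |ψ n (α * τ) x v - torusHeatSolution κ (modeDensity n (a₁ n) (a₂ n)) τ x|) := by
        rw [Finset.mul_sum]
        refine Finset.sum_congr rfl fun n _ => ?_
        rw [abs_mul, abs_of_nonneg (hw n)]
        ring
    _ ≤ ∑ n ∈ S, w n * e' := Finset.sum_le_sum fun n hn =>
        mul_le_mul_of_nonneg_left (hbound n hn) (hw n)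
    _ = Λ * e' := by rw [← Finset.sum_mul]
    _ ≤ e := by
        rw [he', mul_div_assoc', div_le_iff₀ (by positivity)]
        nlinarith

/-- **BGSR (6.3) from its single-mode case**: the hydrodynamic limit (6.3) for every continuous
probability density follows from the statement for the elementary single-mode densities
`1 + a₁ cos(2π n·x) + a₂ sin(2π n·x)` (`bgsr_hydrodynamicLimit_trigPoly_of_mode`, then
`bgsr_hydrodynamicLimit_of_trigPoly`). [cite: BodineauGallagherSaintRaymondInvent2016, (6.3) and §6.1.1] -/
theorem bgsr_hydrodynamicLimit_of_mode (h : bgsr_hydrodynamicLimit_mode (d := d)) :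
    bgsr_hydrodynamicLimit (d := d) :=
  bgsr_hydrodynamicLimit_of_trigPoly (bgsr_hydrodynamicLimit_trigPoly_of_mode h)

end

end Literature.MathematicalPhysics.KineticTheory
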